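import Summits.BirchSwinnertonDyer.BirchSwinnertonDyer.Theorems.PrintCFramBottomClassIndexLawFiveLeParitySplitPrimitivityFieldFactor
import Summits.BirchSwinnertonDyer.BirchSwinnertonDyer.Theorems.PrintCFramBottomClassIndexLawFiveLeKrizLiLocusOfPrintsFour
import Summits.BirchSwinnertonDyer.BirchSwinnertonDyer.Theorems.PrintCFramBottomClassIndexLawFiveLeEisensteinSockets
import HarnessLib

/-!
# Crux `PrintCFram.BottomClassIndexLawFiveLe` (stmt-BirchSwinnertonDyer-20372), line `eisenstein-resource-bdp-line` (registry v19):
# ON THE KRIZ–LI LOCUS THE HEEGNER POINT IS `p`-PRIMITIVE UP TO THE MANIN CONSTANT — FROM PRINT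
# (cell `bsd-print-cfram`, width seat `bsd-line-cfram-p1-w3` g9; THEOREMS ONLY, `--supports` 20372; BSD is not proved by any of this)

HONEST FRAMING. THEOREMS ONLY (0 defs / 0 facts / 0 sorry); no stub is closed; no summit statement is proved by this seat; the crux C2
stays OPEN and is NOT claimed false; everything is CONDITIONAL on the displayed refereed named facts. The (KL) branch of the registered
composition proves `BSD_p(W)` on the Kriz–Li locus from FOUR refereed facts + Kriz–Li Thm. 1.20
(`KrizLiLocusOfPrintsFour.bsdp_cmRamified_of_krizLiDatum_of_prints4`, w7 g2); the field-factor socket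
(`ParitySplit.bsdp_iff_heegnerIndex_of_krizLiFour_of_hss`, this seat) says that under Kriz–Li's hypothesis (4) `BSD_p(W)` is EQUIVALENT
to the `p`-primitivity of the Heegner point up to Manin; the partner's `BSD_p` is Burungale–Flach on the class
(`EisensteinResourceBdpLine.rankZeroTwistBSDp_of_hasCM`). Hence:

* **`padicValNat_heegnerIndex_eq_of_krizLiDatum_of_prints4`** — for every class member (`W/ℚ` globally minimal with CM, `p ≥ 5`
  CM-ramified, `r_an(W) = 1`) and every Kriz–Li datum of the composition at an admissible Heegner field `K''` (`d` odd `< −4`,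
  `L(W^{(d)},1) ≠ 0`, `(ψ, ω, ε_{K''})` in trace form with (1), (3), (4)) — VERBATIM the binders of the (KL) case of
  `EisensteinResourceBdpLine.BottomClassIndexLawFiveLe_of` — granting the four print facts, Kriz–Li Thm. 1.20 and the Cassels–Tate
  pairing: **`ord_p [W(K''):ℤP_{K''}] = v_p(c)`** for the Heegner point `P_{K''}` of ANY parametrisation datum `Dt` (constant `c`):
  the `p`-part of the Gross–Zagier index is the Manin part (Kolyvagin-primitivity of the bottom Heegner class at an Eisenstein
  ADDITIVE prime, on 63/65 rank-one window classes of the `≥ 5` leaf — the first layer of the LEAD g11 reading «B1 ∩ small-Selmer =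
  Heegner `p`-primitivity», report §3/§5, on the locus where print decides it).
* `not_dvd_heegnerIndex_of_krizLiDatum_of_prints4` — with `p ∤ c` and the index finite: `p ∤ [W(K''):ℤP_{K''}]`.

beyond-print theorem: NO (a corollary of print: Kriz–Li + Gross–Zagier + Burungale–Flach + Cassels–Tate through the tree's exact
Heegner-index bookkeeping `SchneiderFree.exists_shaAn_padicVal_eq_of_heegner_manin`). References: Kriz–Li 2019 Thm. 1.20, (29);
Gross–Zagier 1986 I.(6.3), V.§2 (2.2); Burungale–Flach 2024 Cor. 2; Cassels 1962 IV; crux workfile `Lines/eisenstein-resource-bdp-line-lead-g11.md` §5.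
-/

set_option autoImplicit false
-- `…BirchSwinnertonDyer.BirchSwinnertonDyer.Theorems…` is the problem's mandated namespace (D-0017).
set_option linter.dupNamespace false

noncomputable section

open scoped Classical

namespace Summit.BirchSwinnertonDyer.BirchSwinnertonDyer.Theorems.PrintCFram.ParitySplit

open WeierstrassCurve NumberField IsDedekindDomain DirichletCharacter
  Literature.NumberTheory.EllipticCurves
  Literature.NumberTheory.EllipticCurves.ModularForms
  Literature.NumberTheory.EllipticCurves.Rank1Residual
  Literature.NumberTheory.EllipticCurves.Rank1Residual.Typed
  Literature.NumberTheory.EllipticCurves.KrizLi2019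
  Summit.BirchSwinnertonDyer.Rank1Residual
  Summit.BirchSwinnertonDyer.BirchSwinnertonDyer.Theses.UniversalToricDescent
  Summit.BirchSwinnertonDyer.BirchSwinnertonDyer.Theorems
  Summit.BirchSwinnertonDyer.BirchSwinnertonDyer.Theorems.SchneiderFree
  Summit.BirchSwinnertonDyer.BirchSwinnertonDyer.Theorems.PrintCFram

/-- **ON THE KRIZ–LI LOCUS THE HEEGNER POINT IS `p`-PRIMITIVE UP TO MANIN (from print).** Granting the FOUR refereed facts of `stub_prints`
(Hsieh 2014 Thm. A, Liu–Zhang–Zhang 2018, `ToricPublishedInputs`, Burungale–Flach 2024 Cor. 2), Kriz–Li 2019 Thm. 1.20 and the Cassels–Tate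
pairing: for every `W/ℚ` globally minimal with CM, `CMRamified W p`, `p ≥ 5`, `r_an(W) = 1`, every admissible Heegner field `K` (`N_W`-Heegner,
`d_K` odd `< −4`, `L(W^{(d_K)},1) ≠ 0`), every Kriz–Li datum `(f, ψ, ω, ε_K)` of the composition at `K` (ψ primitive, `ω` Teichmüller, trace
form, (1), (3), (4)), every parametrisation datum `Dt` (constant `c`) with Heegner datum `H`, embedding `ι` and Heegner point `P ∈ W(K)`, and
any globally minimal model `Wd` of the twist: **`ord_p [W(K):ℤP] = v_p(c)`**. Proof: `BSD_p(W)` by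
`KrizLiLocusOfPrintsFour.bsdp_cmRamified_of_krizLiDatum_of_prints4`, `BSD_p(Wd)` by `EisensteinResourceBdpLine.rankZeroTwistBSDp_of_hasCM`
(Burungale–Flach), and `ParitySplit.bsdp_iff_heegnerIndex_of_krizLiFour_of_hss` (`.mp`). CONDITIONAL on the named facts; closes no stub.
[cite: KrizLi2019, Thm. 1.20 (pp. 7–8), Rem. 1.21 (p. 8), (29) (pp. 49–50)] [cite: GrossZagier1986, Thm. I.(6.3) and V.§2 (pp. 310–312)]
[cite: BurungaleFlach2024, Thm. 1.1 and Cor. 2] [cite: Cassels1962ArithmeticIV] -/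
theorem padicValNat_heegnerIndex_eq_of_krizLiDatum_of_prints4 {p : ℕ} [Fact p.Prime]
    (hprints : Hsieh2014.thmA_exists_isHsiehLFunction_unrPeriod_anyLevel ∧
      LiuZhangZhang2018.thm151_thm153_modularCurve_heegnerVector_additive ∧
      ToricPublishedInputs ∧
      bsdTriple_of_hasCM_of_L_one_ne_zero)
    (hKL : KrizLi2019.thm120_padicLogHeegner_unit_of_bernoulli)
    (hCT : exists_casselsTate_pairing (K := ℚ))
    (W : WeierstrassCurve ℚ) [W.IsElliptic] [W.IsGloballyMinimal] (hCM : W.HasCM) (hram : CMRamified W p) (h5 : 5 ≤ p)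
    (hr : W.analyticRank = 1)
    (N : ℕ) [NeZero N] (K : Type) [Field K] [NumberField K]
    (Dt : ModularParametrizationData W N) (H : HeegnerDatum N (NumberField.discr K)) (ι : K →+* ℂ)
    (P : (W.baseChange K).toAffine.Point)
    {f : ℕ} [NeZero f] (ψ : DirichletCharacter ℚ_[p] f) (ω : DirichletCharacter ℚ_[p] p)
    (εK : DirichletCharacter ℚ_[p] (NumberField.discr K).natAbs)
    (hN : W.conductorNorm ℤ = N) (hK : IsImaginaryQuadratic K) (hHN : SatisfiesHeegnerHypothesis N K)
    (hodd : Odd (NumberField.discr K)) (hd4 : NumberField.discr K < -4)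
    (hLt : (W.quadraticTwist (NumberField.discr K : ℚ)).entireLFunction 1 ≠ 0)
    (hP : WeierstrassCurve.Affine.Point.map ι.toRatAlgHom P = heegnerPointComplex Dt H)
    (hψ : ψ.IsPrimitive) (hω : IsTeichmullerCharacter ω)
    (hss : ∀ ℓ : ℕ, ℓ.Prime → ¬ (ℓ ∣ p * W.conductorNorm ℤ) →
      ‖((W.LFunction ℓ : ℤ) : ℚ_[p]) - (ψ (ℓ : ZMod f) + ψ⁻¹ (ℓ : ZMod f) * ω (ℓ : ZMod p))‖ < 1)
    (h1 : ψ (p : ZMod f) ≠ 1) (h1' : primVal (invMulOmega ψ ω) p ≠ 1)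
    (h3 : ∀ ℓ : ℕ, (hℓ : ℓ.Prime) → ℓ ≠ p →
      (haveI := Fact.mk hℓ; ¬ W.HasGoodReductionAtPrime ℓ ∧ ¬ W.HasMultiplicativeReductionAtPrime ℓ) →
      ψ (ℓ : ZMod f) ≠ 1 ∧ primVal (invMulOmega ψ ω) ℓ ≠ 1)
    (hεK : IsKroneckerCharacterOf K εK)
    (h4 : ¬ ‖bernoulliOnePrim (bernoulliCharOne ψ εK) * bernoulliOnePrim (bernoulliCharTwo ψ εK ω)‖ ≤ (p : ℝ)⁻¹)
    (Wd : WeierstrassCurve ℚ) [Wd.IsElliptic] [Wd.IsGloballyMinimal]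
    (hC : ∃ C : VariableChange ℚ, C • W.quadraticTwist (NumberField.discr K : ℚ) = Wd) :
    padicValNat p (AddSubgroup.zmultiples P).index = padicValNat p Dt.c.natAbs := by
  obtain ⟨hGZ, hKo, hGZK, hmod, -, -, hGZ73, -⟩ := hprints.2.2.1
  have hBF := hprints.2.2.2
  -- the partner's `BSD_p` (Burungale–Flach on the rank-zero CM twist)
  have hWd : BSDp Wd p := EisensteinResourceBdpLine.rankZeroTwistBSDp_of_hasCM hBF hmod W hCM N K Wd hN hK hHN hC hLt
  -- `BSD_p(W)` on the Kriz–Li locus, from print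
  have hW : BSDp W p :=
    KrizLiLocusOfPrintsFour.bsdp_cmRamified_of_krizLiDatum_of_prints4 hprints hKL W hCM hram h5 hr
      ⟨N, inferInstance, K, inferInstance, inferInstance, Dt, H, ι, P, f, inferInstance, ψ, ω, εK, hN, hK, hHN, hodd, hd4, hLt, hP,
        hψ, hω, hss, h1, h1', h3, hεK, h4⟩
  exact (bsdp_iff_heegnerIndex_of_krizLiFour_of_hss hGZ hKo hGZK hmod hGZ73 hCT W hCM hram h5 hr ψ ω hω hss N K Dt H ι P Wd hN hK
    hHN hodd hd4 hLt hP hC εK hεK h4 hWd).mp hW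

/-- **`p ∤ [W(K):ℤP]` on the Kriz–Li locus when `p ∤ c`** (e.g. an optimal parametrisation of a class member) and the index is finite
(`[W(K):ℤP] ≠ 0`; automatic here — `rank W(K) = 1`, `P` non-torsion — but taken as a binder): the Heegner point is `p`-PRIMITIVE in `W(K)`.
Same inputs as `padicValNat_heegnerIndex_eq_of_krizLiDatum_of_prints4`. CONDITIONAL; closes no stub.
[cite: KrizLi2019, Thm. 1.20 (pp. 7–8)] [cite: GrossZagier1986, Thm. I.(6.3) and V.§2 (pp. 310–312)] [cite: BurungaleFlach2024, Thm. 1.1 and Cor. 2] -/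
theorem not_dvd_heegnerIndex_of_krizLiDatum_of_prints4 {p : ℕ} [hp : Fact p.Prime]
    (hprints : Hsieh2014.thmA_exists_isHsiehLFunction_unrPeriod_anyLevel ∧
      LiuZhangZhang2018.thm151_thm153_modularCurve_heegnerVector_additive ∧
      ToricPublishedInputs ∧
      bsdTriple_of_hasCM_of_L_one_ne_zero)
    (hKL : KrizLi2019.thm120_padicLogHeegner_unit_of_bernoulli)
    (hCT : exists_casselsTate_pairing (K := ℚ))
    (W : WeierstrassCurve ℚ) [W.IsElliptic] [W.IsGloballyMinimal] (hCM : W.HasCM) (hram : CMRamified W p) (h5 : 5 ≤ p)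
    (hr : W.analyticRank = 1)
    (N : ℕ) [NeZero N] (K : Type) [Field K] [NumberField K]
    (Dt : ModularParametrizationData W N) (H : HeegnerDatum N (NumberField.discr K)) (ι : K →+* ℂ)
    (P : (W.baseChange K).toAffine.Point)
    {f : ℕ} [NeZero f] (ψ : DirichletCharacter ℚ_[p] f) (ω : DirichletCharacter ℚ_[p] p)
    (εK : DirichletCharacter ℚ_[p] (NumberField.discr K).natAbs)
    (hN : W.conductorNorm ℤ = N) (hK : IsImaginaryQuadratic K) (hHN : SatisfiesHeegnerHypothesis N K)
    (hodd : Odd (NumberField.discr K)) (hd4 : NumberField.discr K < -4)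
    (hLt : (W.quadraticTwist (NumberField.discr K : ℚ)).entireLFunction 1 ≠ 0)
    (hP : WeierstrassCurve.Affine.Point.map ι.toRatAlgHom P = heegnerPointComplex Dt H)
    (hψ : ψ.IsPrimitive) (hω : IsTeichmullerCharacter ω)
    (hss : ∀ ℓ : ℕ, ℓ.Prime → ¬ (ℓ ∣ p * W.conductorNorm ℤ) →
      ‖((W.LFunction ℓ : ℤ) : ℚ_[p]) - (ψ (ℓ : ZMod f) + ψ⁻¹ (ℓ : ZMod f) * ω (ℓ : ZMod p))‖ < 1)
    (h1 : ψ (p : ZMod f) ≠ 1) (h1' : primVal (invMulOmega ψ ω) p ≠ 1)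
    (h3 : ∀ ℓ : ℕ, (hℓ : ℓ.Prime) → ℓ ≠ p →
      (haveI := Fact.mk hℓ; ¬ W.HasGoodReductionAtPrime ℓ ∧ ¬ W.HasMultiplicativeReductionAtPrime ℓ) →
      ψ (ℓ : ZMod f) ≠ 1 ∧ primVal (invMulOmega ψ ω) ℓ ≠ 1)
    (hεK : IsKroneckerCharacterOf K εK)
    (h4 : ¬ ‖bernoulliOnePrim (bernoulliCharOne ψ εK) * bernoulliOnePrim (bernoulliCharTwo ψ εK ω)‖ ≤ (p : ℝ)⁻¹)
    (Wd : WeierstrassCurve ℚ) [Wd.IsElliptic] [Wd.IsGloballyMinimal]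
    (hC : ∃ C : VariableChange ℚ, C • W.quadraticTwist (NumberField.discr K : ℚ) = Wd)
    (hc : ¬ p ∣ Dt.c.natAbs) (hI : (AddSubgroup.zmultiples P).index ≠ 0) :
    ¬ p ∣ (AddSubgroup.zmultiples P).index := by
  have hidx := padicValNat_heegnerIndex_eq_of_krizLiDatum_of_prints4 hprints hKL hCT W hCM hram h5 hr N K Dt H ι P ψ ω εK hN hK hHN
    hodd hd4 hLt hP hψ hω hss h1 h1' h3 hεK h4 Wd hC
  rw [padicValNat.eq_zero_of_not_dvd hc] at hidx
  intro hdvd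
  rcases padicValNat.eq_zero_iff.mp hidx with h | h | h
  · exact hp.out.one_lt.ne' h
  · exact hI h
  · exact h hdvd

end Summit.BirchSwinnertonDyer.BirchSwinnertonDyer.Theorems.PrintCFram.ParitySplit

end
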